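import Literature.AlgebraicGeometry.Resolution.TangentDirections
import Literature.AlgebraicGeometry.Resolution.DerivativeIdealsSupport
import Literature.AlgebraicGeometry.Resolution.ProjectiveSpaceRegular
import Literature.AlgebraicGeometry.Resolution.SmoothImpliesRegular
import Mathlib.RingTheory.Localization.Ideal
import HarnessLib

/-!
# Hypersurfaces of maximal contact exist locally (BGMW 2011, §3.6, Lemma 3.6.4 (1)–(2))

Topic: `Literature/AlgebraicGeometry/Resolution`. Bierstone–Grigoriev–Milman–Włodarczyk, *Effective
Hironaka resolution and its complexity (with appendix on applications in positive
characteristic)*, arXiv:1206.3090, **§3.6 "Hypersurfaces of maximal contact"** (pp. 7–8, arXiv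
numbering), continuing `TangentDirections.lean` (Def. 3.6.1 `IsOfMaxOrder`, Lemma 3.6.3,
existence of a tangent direction AT A POINT of the support, Lemma 3.6.4 (2), Lemma 3.6.4 (1) at a
point) with the NEIGHBOURHOOD statements that Lemma 3.6.4 actually assumes and concludes:

  **Lemma 3.6.4** (Giraud). "Let `(𝓘, μ)` be a marked ideal of maximal order. … Let
  `u ∈ 𝒟^{μ-1}(𝓘, μ)(U)` be a function such that, for any `x ∈ V(u)`, `ord_x(u) = 1`. Then
  (1) `V(u)` is smooth; (2) `supp(𝓘, μ) ∩ U ⊂ V(u)`."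

* `MarkedIdeal.isOfMaxOrder_iff_forall_idealOrder_le` — **Def. 3.6.1, both formulations**:
  `𝒟^μ(𝓘) = 𝒪_X ⇔ ord_x 𝓘 ≤ μ` for all `x` (local coordinates, `1, …, μ` units: characteristic
  zero or `μ < p`, Thm. 8.0.4; the implication `⇒` is characteristic-free,
  `IsOfMaxOrder.idealOrder_le` in `TangentDirections.lean`);
* `germ_mem_sq_iff_mem_zeroLocus_derivIdeal` — **the locus `{y ∈ U | ord_y(u) ≥ 2}` of a section
  `u` is closed**, equal to `U ∩ V(𝒟((u)))` (Lemma 3.5.2 for the marked ideal `((u), 2)`; needs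
  local coordinates only, no hypothesis on the characteristic);
* `MarkedIdeal.IsOfMaxOrder.exists_tangentDirection_of_order_one` — **the hypothesis of
  Lemma 3.6.4 can be met locally**: for `(𝓘, μ)`, `μ ≥ 1`, of maximal order and `x ∈ supp(𝓘, μ)`
  there are an affine open `U ∋ x` and `u ∈ 𝒟^{μ-1}(𝓘)(U)` vanishing at `x` with `ord_y(u) = 1`
  for EVERY `y ∈ V(u) ∩ U` (take the tangent direction at `x` of
  `IsOfMaxOrder.exists_tangentDirection_section` and shrink `U` off the closed locus above) —
  characteristic-free given local coordinates (BGMW §2, p. 5: characteristic zero "is only needed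
  for the local existence of a hypersurface of maximal contact"; in the present rendering it enters
  only through Def. 3.6.1's equivalence, i.e. through `isOfMaxOrder_iff_forall_idealOrder_le`);
* `isRegularRing_quotient_span_singleton_of_order_one`, `isRegular_hypersurface_of_order_one` —
  **Lemma 3.6.4 (1)** for the whole hypersurface: on a locally Noetherian regular scheme, if
  `u ∈ Γ(X, U)` has order one at every point of `V(u) ∩ U` then `Γ(X, U) ⧸ (u)` is a regular ring,
  i.e. `V(u) = Spec (Γ(X, U)/(u))` is a regular scheme (its local rings are the
  `𝒪_{X,y}/(u_y)` of `IsRegularLocalRing.quotient_span_singleton`, Matsumura Thm. 14.2);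
* `Scheme.isRegular_of_smooth_over_field` — a scheme smooth over a field is regular
  (EGA IV 17.5.8 (iii); Görtz–Wedhorn Lemma 6.26; via `isRegularLocalRing_of_isSmoothAt`);
* `MarkedIdeal.exists_maximalContact_of_smooth` — **on a scheme smooth over a perfect field,
  every point of the support of a marked ideal of maximal order (`μ ≥ 1`) has an affine
  neighbourhood `U` and a tangent direction `u ∈ 𝒟^{μ-1}(𝓘)(U)` of order one along `V(u) ∩ U`,
  whose hypersurface `V(u)` is regular and contains `supp(𝓘, μ) ∩ U`** (Lemma 3.6.4 (1)–(2)
  with its hypothesis discharged).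

The persistence statements (Lemma 3.6.2, Lemma 3.6.4 (3)–(6), Lemma 3.6.6) concern controlled
transforms under admissible blow-ups (Lemma 3.5.3, `DerivativeIdealsChart.lean`) and are not
treated here.

## Sources

* [BGMW 2011] §2 p. 5; §3.6: Def. 3.6.1, Lemma 3.6.4, Def. 3.6.5 and Remarks (1); §3.5
  Lemma 3.5.2; §4 Step 1b (p. 11); §8 Thm. 8.0.4 (arXiv:1206.3090 numbering).
  [BierstoneGrigorievMilmanWlodarczyk2011]
* H. Matsumura, *Commutative Ring Theory* (1986), Thm. 14.2 — through
  `RegularLocalRingsQuotient.lean`. [Matsumura1987]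
* U. Görtz, T. Wedhorn, *Algebraic Geometry I*, 2nd ed. (2020), Lemma 6.26 — through
  `SmoothImpliesRegular.lean`. [GortzWedhorn2020]
-/

namespace Literature.AlgebraicGeometry.Resolution

open CategoryTheory _root_.AlgebraicGeometry TopologicalSpace IsLocalRing Opposite

universe u v

section Local

variable {k : Type v} [CommRing k] {X : Scheme.{u}} {φ : k →+* Γ(X, ⊤)}

/-! ## Def. 3.6.1: the two formulations of "maximal order" agree -/

/-- **BGMW Def. 3.6.1, the two formulations agree**: `(𝓘, μ)` is of maximal order
(`𝒟^μ(𝓘) = 𝒪_X`) iff `ord_x(𝓘) ≤ μ` for all `x ∈ X` — on a scheme with finitely presented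
differentials and local coordinates in whose local rings `1, …, μ` are units (characteristic
zero, or `μ < p`, Thm. 8.0.4). The implication `⇒` holds in every characteristic
(`IsOfMaxOrder.idealOrder_le`). [cite: BierstoneGrigorievMilmanWlodarczyk2011, Def. 3.6.1] -/
theorem MarkedIdeal.isOfMaxOrder_iff_forall_idealOrder_le (hX : HasFinitePresentationDifferentials φ)
    (hc : HasLocalCoordinates φ) (M : MarkedIdeal X)
    (hunit : ∀ (x : X) (j : ℕ), 0 < j → j ≤ M.mult → IsUnit (j : X.presheaf.stalk x)) :
    M.IsOfMaxOrder φ ↔ ∀ x : X, idealOrder M.ideal x ≤ M.mult :=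
  derivIdealSheafIter_eq_top_iff hX hc M.ideal hunit

/-! ## The locus `{ord_y u ≥ 2}` of a section is closed: it is `V(𝒟(u))` -/

/-- For a section `u` over an affine open `U` and `y ∈ U`: **`ord_y(u) ≥ 2` iff `y ∈ V(𝒟((u)))`**,
`𝒟((u)) ⊆ Γ(X, U)` the derivative ideal of `(u)` (Lemma 3.5.2 for the marked ideal `((u), 2)` at
`y`: `(u_y) ⊆ 𝔪_y² ⇔ 𝒟((u_y)) ⊆ 𝔪_y`, and `𝒟` commutes with localization). In particular the
locus `{y ∈ U | ord_y(u) ≥ 2}` is closed in `U`. Needs local coordinates only (the integer `1`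
being a unit): no hypothesis on the characteristic.
[cite: BierstoneGrigorievMilmanWlodarczyk2011, Lemma 3.5.2] -/
theorem germ_mem_sq_iff_mem_zeroLocus_derivIdeal (hX : HasFinitePresentationDifferentials φ)
    (hc : HasLocalCoordinates φ) (U : X.affineOpens) (u : Γ(X, U)) {y : X}
    (hy : y ∈ (U : X.Opens)) :
    X.presheaf.germ U y hy u ∈ maximalIdeal (X.presheaf.stalk y) ^ 2 ↔
      y ∈ X.zeroLocus (U := U)
        (letI := sectionsAlgebra φ U; (derivIdeal k (Ideal.span {u}) : Set Γ(X, U))) := by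
  letI := sectionsAlgebra φ U
  letI := stalkAlgebra φ y
  letI algy : Algebra Γ(X, U) (X.presheaf.stalk y) := (X.presheaf.germ U y hy).hom.toAlgebra
  haveI : IsScalarTower k Γ(X, U) (X.presheaf.stalk y) :=
    IsScalarTower.of_algebraMap_eq fun c =>
      (RingHom.congr_fun (germ_comp_sectionsHom φ U y hy) c).symm
  haveI : IsLocalization.AtPrime (X.presheaf.stalk y) (U.2.primeIdealOf ⟨y, hy⟩).asIdeal :=
    U.2.isLocalization_stalk ⟨y, hy⟩
  haveI := hX U
  obtain ⟨c⟩ := hc y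
  have h2 := c.le_pow_iff_derivIdealIter_le_pow (μ := 2)
    (fun j hj hj2 => by obtain rfl : j = 1 := (by omega); exact_mod_cast isUnit_one)
    (Ideal.span {X.presheaf.germ U y hy u}) (i := 1) one_lt_two
  rw [derivIdealIter_one, show (2 : ℕ) - 1 = 1 from rfl, pow_one] at h2
  have h3 : Ideal.span {X.presheaf.germ U y hy u} =
      (Ideal.span {u}).map (algebraMap Γ(X, U) (X.presheaf.stalk y)) := by
    rw [Ideal.map_span, Set.image_singleton]; rfl
  rw [← Ideal.span_singleton_le_iff_mem, h2, h3,
    derivIdeal_map_of_isLocalization k (X.presheaf.stalk y)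
      (U.2.primeIdealOf ⟨y, hy⟩).asIdeal.primeCompl (Ideal.span {u}),
    Ideal.map_le_iff_le_comap, Scheme.mem_zeroLocus_iff]
  refine forall₂_congr fun g _ => ?_
  rw [Ideal.mem_comap, X.mem_basicOpen g y hy, IsLocalRing.mem_maximalIdeal, mem_nonunits_iff]
  rfl

/-! ## Tangent directions of order one along their hypersurface -/

/-- **The hypothesis of Lemma 3.6.4 can be met locally** (BGMW §3.6 Remarks (1): "Tangent
directions are functions locally defining hypersurfaces of maximal contact"; §4 Step 1b, p. 11:
"find a tangent direction `u_α ∈ 𝒟^{μ(𝓙)-1}(𝓙)` on some neighborhood `U_α` of `x`. Then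
`V(u_α) ⊂ U_α` is a hypersurface of maximal contact"): for `(𝓘, μ)`, `μ ≥ 1`, of maximal order on a
scheme with finitely presented differentials and local coordinates, every `x ∈ supp(𝓘, μ)` has an
affine open neighbourhood `U` and a section `u ∈ 𝒟^{μ-1}(𝓘)(U)` vanishing at `x` with
**`ord_y(u) = 1` for every `y ∈ V(u) ∩ U`**: shrink the neighbourhood of the tangent direction at
`x` (`IsOfMaxOrder.exists_tangentDirection_section`) off the closed locus `{ord_y u ≥ 2} = V(𝒟(u))`
(`germ_mem_sq_iff_mem_zeroLocus_derivIdeal`). Characteristic-free.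
[cite: BierstoneGrigorievMilmanWlodarczyk2011, Lemma 3.6.4 with Def. 3.6.5] -/
theorem MarkedIdeal.IsOfMaxOrder.exists_tangentDirection_of_order_one
    (hX : HasFinitePresentationDifferentials φ) (hc : HasLocalCoordinates φ) {M : MarkedIdeal X}
    (h : M.IsOfMaxOrder φ) (hμ : 1 ≤ M.mult) {x : X} (hx : x ∈ M.support) :
    ∃ (U : X.affineOpens) (hxU : x ∈ (U : X.Opens)) (u : Γ(X, U)),
      u ∈ (derivIdealSheafIter φ (M.mult - 1) M.ideal).ideal U ∧
        X.presheaf.germ U x hxU u ∈ maximalIdeal (X.presheaf.stalk x) ∧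
        ∀ (y : X) (hy : y ∈ (U : X.Opens)),
          X.presheaf.germ U y hy u ∉ maximalIdeal (X.presheaf.stalk y) ^ 2 := by
  -- a tangent direction `u₀` at `x` on some affine neighbourhood `U₀`
  obtain ⟨U₀', hU₀, hxU₀, -⟩ :=
    exists_isAffineOpen_mem_and_subset (X := X) (x := x) (U := ⊤) (Opens.mem_top x)
  set U₀ : X.affineOpens := ⟨U₀', hU₀⟩
  obtain ⟨u₀, hu₀, hm, hm2⟩ := h.exists_tangentDirection_section hX hμ hx U₀ hxU₀
  letI := sectionsAlgebra φ U₀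
  -- the closed locus `Z = {ord_y u₀ ≥ 2} = V(𝒟(u₀))` misses `x`
  set Z : Set X := X.zeroLocus (U := U₀) (derivIdeal k (Ideal.span {u₀}) : Set Γ(X, U₀)) with hZ
  have hZc : IsClosed Z := X.zeroLocus_isClosed _
  have hxZ : x ∉ Z := fun hxZ =>
    hm2 ((germ_mem_sq_iff_mem_zeroLocus_derivIdeal hX hc U₀ u₀ hxU₀).mpr hxZ)
  -- an affine neighbourhood `V ∋ x` inside `U₀ ∖ Z`
  let W : X.Opens := ⟨(U₀ : Set X) ∩ Zᶜ, U₀.1.isOpen.inter hZc.isOpen_compl⟩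
  obtain ⟨V, hV, hxV, hVW⟩ :=
    exists_isAffineOpen_mem_and_subset (X := X) (x := x) (U := W) ⟨hxU₀, hxZ⟩
  have hVU₀ : V ≤ (U₀ : X.Opens) := fun y hy => (hVW hy).1
  refine ⟨⟨V, hV⟩, hxV, X.presheaf.map (homOfLE hVU₀).op u₀, ?_, ?_, ?_⟩
  · rw [← (derivIdealSheafIter φ (M.mult - 1) M.ideal).map_ideal (U := ⟨V, hV⟩) (V := U₀) hVU₀]
    exact Ideal.mem_map_of_mem _ hu₀
  · rw [TopCat.Presheaf.germ_res_apply X.presheaf (homOfLE hVU₀) x hxV u₀]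
    exact hm
  · intro y hy hy2
    rw [TopCat.Presheaf.germ_res_apply X.presheaf (homOfLE hVU₀) y hy u₀] at hy2
    exact (hVW hy).2 ((germ_mem_sq_iff_mem_zeroLocus_derivIdeal hX hc U₀ u₀ (hVU₀ hy)).mp hy2)

end Local

/-! ## Lemma 3.6.4 (1): hypersurfaces cut out by a section of order one are regular -/

section Hypersurface

variable {X : Scheme.{u}}

/-- **BGMW Lemma 3.6.4 (1)** ("`V(u)` is smooth"), scheme-theoretic form: on a locally Noetherian
regular scheme `X`, if a section `u ∈ Γ(X, U)` over an affine open `U` has order exactly one at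
every point of `V(u) ∩ U` (`u_y ∈ 𝔪_y ⇒ u_y ∉ 𝔪_y²`), then `Γ(X, U) ⧸ (u)` is a regular ring: its
localization at a prime is `𝒪_{X,y} ⧸ (u_y)` for the corresponding point `y ∈ V(u)`, regular by
Matsumura Thm. 14.2 (`IsRegularLocalRing.quotient_span_singleton`).
[cite: BierstoneGrigorievMilmanWlodarczyk2011, Lemma 3.6.4 (1)] -/
theorem isRegularRing_quotient_span_singleton_of_order_one [IsLocallyNoetherian X]
    (hreg : Scheme.IsRegular X) {U : X.Opens} (hU : IsAffineOpen U) (u : Γ(X, U))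
    (hu : ∀ (y : X) (hy : y ∈ U), X.presheaf.germ U y hy u ∈ maximalIdeal (X.presheaf.stalk y) →
      X.presheaf.germ U y hy u ∉ maximalIdeal (X.presheaf.stalk y) ^ 2) :
    IsRegularRing (Γ(X, U) ⧸ Ideal.span {u}) := by
  haveI : IsNoetherianRing Γ(X, U) := IsLocallyNoetherian.component_noetherian ⟨U, hU⟩
  rw [isRegularRing_iff]
  intro q hq
  -- the prime `𝔭 ⊇ (u)` of `Γ(X, U)` below `q`, and the corresponding point `y ∈ U`
  let p : Ideal Γ(X, U) := q.comap (Ideal.Quotient.mk (Ideal.span {u}))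
  haveI hp : p.IsPrime := Ideal.comap_isPrime _ _
  let y' : PrimeSpectrum Γ(X, U) := ⟨p, hp⟩
  have hy : hU.fromSpec y' ∈ U := by
    rw [← SetLike.mem_coe, ← hU.range_fromSpec]
    exact ⟨y', rfl⟩
  letI : Algebra Γ(X, U) (X.presheaf.stalk (hU.fromSpec y')) :=
    TopCat.Presheaf.algebra_section_stalk X.presheaf ⟨hU.fromSpec y', hy⟩
  haveI : IsLocalization.AtPrime (X.presheaf.stalk (hU.fromSpec y')) p :=
    hU.isLocalization_stalk' y' hy
  haveI := hreg (hU.fromSpec y')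
  -- `u ∈ 𝔭`, so `u_y ∈ 𝔪_y ∖ 𝔪_y²`
  have hup : u ∈ p := by
    change Ideal.Quotient.mk (Ideal.span {u}) u ∈ q
    rw [Ideal.Quotient.eq_zero_iff_mem.mpr (Ideal.subset_span (Set.mem_singleton u))]
    exact q.zero_mem
  have hum : X.presheaf.germ U _ hy u ∈ maximalIdeal (X.presheaf.stalk (hU.fromSpec y')) :=
    (IsLocalization.AtPrime.to_map_mem_maximal_iff (X.presheaf.stalk (hU.fromSpec y')) p u).mpr
      hup
  have hum2 := hu _ hy hum
  haveI hregq := (IsRegularLocalRing.quotient_span_singleton hum hum2).1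
  -- `(Γ(X, U)/(u))_q ≅ 𝒪_y/(u_y)`: both are localizations of `Γ(X, U)/(u)` at `q`
  set J : Ideal (X.presheaf.stalk (hU.fromSpec y')) :=
    Ideal.map (algebraMap Γ(X, U) (X.presheaf.stalk (hU.fromSpec y'))) (Ideal.span {u}) with hJdef
  have hJ : J = Ideal.span {X.presheaf.germ U _ hy u} := by
    rw [hJdef, Ideal.map_span, Set.image_singleton]
    rfl
  have hM : Algebra.algebraMapSubmonoid (Γ(X, U) ⧸ Ideal.span {u}) p.primeCompl =
      q.primeCompl := by
    ext b
    constructor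
    · rintro ⟨a, ha, rfl⟩
      exact ha
    · intro hb
      obtain ⟨a, rfl⟩ := Ideal.Quotient.mk_surjective b
      exact ⟨a, hb, rfl⟩
  haveI : IsLocalization.AtPrime (X.presheaf.stalk (hU.fromSpec y') ⧸ J) q := by
    rw [IsLocalization.AtPrime, ← hM]
    infer_instance
  haveI : IsRegularLocalRing (X.presheaf.stalk (hU.fromSpec y') ⧸ J) :=
    IsRegularLocalRing.of_ringEquiv (Ideal.quotEquivOfEq hJ.symm)
  exact IsRegularLocalRing.of_ringEquiv
    (IsLocalization.algEquiv q.primeCompl (X.presheaf.stalk (hU.fromSpec y') ⧸ J)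
      (Localization.AtPrime q)).toRingEquiv

/-- Hence **the hypersurface `V(u) = Spec (Γ(X, U)/(u)) ⊆ U` is a regular scheme** (BGMW
Lemma 3.6.4 (1): "`V(u)` is smooth"; regular for smooth).
[cite: BierstoneGrigorievMilmanWlodarczyk2011, Lemma 3.6.4 (1)] -/
theorem isRegular_hypersurface_of_order_one [IsLocallyNoetherian X] (hreg : Scheme.IsRegular X)
    {U : X.Opens} (hU : IsAffineOpen U) (u : Γ(X, U))
    (hu : ∀ (y : X) (hy : y ∈ U), X.presheaf.germ U y hy u ∈ maximalIdeal (X.presheaf.stalk y) →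
      X.presheaf.germ U y hy u ∉ maximalIdeal (X.presheaf.stalk y) ^ 2) :
    Scheme.IsRegular (Spec (.of (Γ(X, U) ⧸ Ideal.span {u}))) :=
  haveI := isRegularRing_quotient_span_singleton_of_order_one hreg hU u hu
  Scheme.isRegular_Spec _

end Hypersurface

/-! ## Schemes smooth over a perfect field: regularity, and maximal contact -/

section Smooth

variable (k : Type u) [Field k] (X : Scheme.{u}) [X.Over (Spec (.of k))]

/-- **Smooth over a field ⇒ regular** (EGA IV 17.5.8 (iii) / Görtz–Wedhorn Lemma 6.26, through
`isRegularLocalRing_of_isSmoothAt`, `SmoothImpliesRegular.lean`): a scheme smooth over `Spec k`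
is a regular scheme. [cite: GortzWedhorn2020, Lemma 6.26 (p. 196)] -/
theorem Scheme.isRegular_of_smooth_over_field [Smooth (X ↘ Spec (.of k))] :
    Scheme.IsRegular X := by
  intro x
  obtain ⟨U, hU, hxU, -⟩ :=
    exists_isAffineOpen_mem_and_subset (X := X) (x := x) (U := ⊤) (Opens.mem_top x)
  letI := sectionsAlgebra (overHom k X) U
  haveI : Algebra.FinitePresentation k Γ(X, U) :=
    (smooth_sectionsHom_overHom k X ⟨U, hU⟩).finitePresentation
  haveI : Algebra.FormallySmooth k Γ(X, U) :=
    (smooth_sectionsHom_overHom k X ⟨U, hU⟩).formallySmooth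
  let q : Ideal Γ(X, U) := (hU.primeIdealOf ⟨x, hxU⟩).asIdeal
  haveI : Algebra.IsSmoothAt k q :=
    Algebra.FormallySmooth.comp k Γ(X, U) (Localization.AtPrime q)
  haveI := isRegularLocalRing_of_isSmoothAt k Γ(X, U) q
  letI : Algebra Γ(X, U) (X.presheaf.stalk x) :=
    TopCat.Presheaf.algebra_section_stalk X.presheaf ⟨x, hxU⟩
  haveI : IsLocalization.AtPrime (X.presheaf.stalk x) q := hU.isLocalization_stalk ⟨x, hxU⟩
  exact IsRegularLocalRing.of_ringEquiv
    (IsLocalization.algEquiv q.primeCompl (Localization.AtPrime q) (X.presheaf.stalk x)).toRingEquiv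

/-- **Hypersurfaces of maximal contact exist locally on a scheme smooth over a perfect field**
(BGMW §3.6, Lemma 3.6.4 (1)–(2) with its hypothesis discharged; §4 Step 1b): for a marked ideal
`(𝓘, μ)`, `μ ≥ 1`, of maximal order (`𝒟^μ(𝓘) = 𝒪_X`) and `x ∈ supp(𝓘, μ)`, there are an affine open
`U ∋ x` and a tangent direction `u ∈ 𝒟^{μ-1}(𝓘)(U)` vanishing at `x`, of order one along
`V(u) ∩ U`, whose hypersurface `V(u) = Spec (Γ(X, U)/(u))` is regular and contains
`supp(𝓘, μ) ∩ U`. (No hypothesis on the characteristic is needed at this point; `μ < p` enters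
through Def. 3.6.1, `MarkedIdeal.isOfMaxOrder_iff_forall_idealOrder_le`.)
[cite: BierstoneGrigorievMilmanWlodarczyk2011, Lemma 3.6.4 (1)–(2)] -/
theorem MarkedIdeal.exists_maximalContact_of_smooth [PerfectField k] [Smooth (X ↘ Spec (.of k))]
    {M : MarkedIdeal X} (h : M.IsOfMaxOrder (overHom k X)) (hμ : 1 ≤ M.mult) {x : X}
    (hx : x ∈ M.support) :
    ∃ (U : X.affineOpens) (hxU : x ∈ (U : X.Opens)) (u : Γ(X, U)),
      u ∈ (derivIdealSheafIter (overHom k X) (M.mult - 1) M.ideal).ideal U ∧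
        X.presheaf.germ U x hxU u ∈ maximalIdeal (X.presheaf.stalk x) ∧
        (∀ (y : X) (hy : y ∈ (U : X.Opens)),
          X.presheaf.germ U y hy u ∉ maximalIdeal (X.presheaf.stalk y) ^ 2) ∧
        Scheme.IsRegular (Spec (.of (Γ(X, U) ⧸ Ideal.span {u}))) ∧
        M.support ∩ (U : Set X) ⊆ X.zeroLocus (U := U) {u} := by
  have hX := hasFinitePresentationDifferentials_overHom k X
  obtain ⟨U, hxU, u, hu, hm, h1⟩ :=
    h.exists_tangentDirection_of_order_one hX (hasLocalCoordinates_overHom k X) hμ hx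
  haveI := isLocallyNoetherian_of_locallyOfFiniteType_over k X
  exact ⟨U, hxU, u, hu, hm, h1,
    isRegular_hypersurface_of_order_one (Scheme.isRegular_of_smooth_over_field k X) U.2 u
      (fun y hy _ => h1 y hy),
    M.support_inter_subset_zeroLocus hX hμ U hu⟩

end Smooth

end Literature.AlgebraicGeometry.Resolution
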